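import Mathlib.Tactic
import HarnessLib

/-!
# Kozma–Nitzan's Question 8 at three relays — the WORLD REDUCTION of the framed atom (T*)^Y, scalar skeleton

Support file (`--supports stmt-CriticalPhenomena-4575`, closed crux; independent mathematics on Kozma–Nitzan's Question 8,
arXiv:2401.12397 §5.5 p. 36), prover `prim-ineq-gen-7` (gen 14).  No definitions, no named facts, no sorries; standard axioms.
Memo `run/shared/lean/prim/prim-ineq-gen-7/FINDING-WORLD-g14.md` §2.

Setting (memo notation).  The framed measure `ν' = μ(· | {x,o} ↮ Y)` is a mixture over the *Y-worlds* `W = C_Y`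
(`x, o ∉ W`) of product measures on `Γ_W = G − W`:  `ν' = Σ_W P'(W)·μ_{Γ_W}`.  In world `W` write `mA W` for the mass of the atom
`A ∈ {OV, OM, E, PV, PM}` and `gA W = ∫_A g` for the integral of the (fixed, increasing, nonnegative) test function `g`; the global
masses/integrals are the `P'`-weighted sums.  Because the inequality (T*) — in the form
`(★)  I_O + d̄·I_PM − c̄·I_P ≥ 0`, `c̄ = ν'(O2)/ν'(P)`, `d̄ = ν'(E)/ν'(PM)` — is LINEAR in the measure for fixed constants, one gets
the exact decomposition
  `(★) = Σ_W P'(W)·(★)_W(c_W, d_W) + CP − CM`,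
with the world's own odds `c_W·mP W = mO2 W`, `d_W·mPM W = mE W`, the pocket means `p W = gP W / mP W`, `m W = gPM W / mPM W`, and
  `CP = Σ_W P'(W)·mO2 W·(p W − p̄)`,  `CM = Σ_W P'(W)·mE W·(m W − m̄)`  (`p̄ = I_P/ν'(P)`, `m̄ = I_PM/ν'(PM)`).
* `PocketCert.tstar_of_worldAgg_abstract` — **(T*)^Y from (T*) in every world and AGG := CP − CM ≥ 0**, as an inequality between
  real numbers over a `Finset` of worlds, everything multiplied out (no divisions: the pocket means `p, m` are primitive variables tied
  to the integrals by `gPV + gPM = (mPV + mPM)·p`, `gPM = mPM·m`).  Conclusion = the cubic margin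
  `ΠM·Π·I_O + Π·E·I_PM − ΠM·O2·I_P ≥ 0` (`= ν'(P)·ν'(PM)·(★)`).
For the x-class `g = f(C_x)` the per-world hypothesis is the tree theorem `PocketCert.tstar_xclass_frameless` (p227473) applied in
`Γ_W`, so the covariance half (T1) of KN Q8@3 with its frame is reduced to the single cross-world covariance inequality AGG ≥ 0
(census 0 / 7.1·10⁵, memo §2; the pocket mean `p W` is NOT monotone in `W`, so AGG ≥ 0 is an averaged statement).
[cite: KozmaNitzan2024, Question 8 (§5.5 p. 36)] [cite: VandenbergHaggstromKahn2005, Thm. 1.3 (p. 4)]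
-/

namespace Summit.CriticalPhenomena.PercolationContinuityZ3.Theorems

namespace PocketCert

open Finset

/-- **World reduction of the framed (T*)**: if every world satisfies (T*) with its own odds
(`0 ≤ gO W + mE W·m W − mO2 W·p W`) and the cross-world aggregation term is nonnegative
(`AGG = CP − CM ≥ 0`, multiplied by `ν'(P)·ν'(PM)`), then the mixture satisfies (T*) with the global odds
(conclusion multiplied by `ν'(P)·ν'(PM)`).  Pure bookkeeping over a `Finset` of worlds; see the module docstring for the dictionary.
[cite: KozmaNitzan2024, Question 8 (§5.5 p. 36)] -/
theorem tstar_of_worldAgg_abstract {ι : Type*} (s : Finset ι)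
    (P mOV mOM mE mPV mPM gOV gOM gPV gPM p m : ι → ℝ)
    (hP : ∀ i ∈ s, 0 ≤ P i) (hPV : ∀ i ∈ s, 0 ≤ mPV i) (hPM : ∀ i ∈ s, 0 ≤ mPM i)
    (hgP : ∀ i ∈ s, gPV i + gPM i = (mPV i + mPM i) * p i)
    (hgPM : ∀ i ∈ s, gPM i = mPM i * m i)
    (hslack : ∀ i ∈ s, 0 ≤ (gOV i + gOM i) + mE i * m i - (mOV i + mOM i + mE i) * p i)
    (hAGG : 0 ≤ (∑ i ∈ s, P i * mPM i) *
        ((∑ i ∈ s, P i * (mPV i + mPM i)) * (∑ i ∈ s, P i * ((mOV i + mOM i + mE i) * p i))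
          - (∑ i ∈ s, P i * (mOV i + mOM i + mE i)) * (∑ i ∈ s, P i * ((mPV i + mPM i) * p i)))
      - (∑ i ∈ s, P i * (mPV i + mPM i)) *
        ((∑ i ∈ s, P i * mPM i) * (∑ i ∈ s, P i * (mE i * m i))
          - (∑ i ∈ s, P i * mE i) * (∑ i ∈ s, P i * (mPM i * m i)))) :
    0 ≤ (∑ i ∈ s, P i * mPM i) * (∑ i ∈ s, P i * (mPV i + mPM i)) * (∑ i ∈ s, P i * (gOV i + gOM i))
      + (∑ i ∈ s, P i * (mPV i + mPM i)) * (∑ i ∈ s, P i * mE i) * (∑ i ∈ s, P i * gPM i)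
      - (∑ i ∈ s, P i * mPM i) * (∑ i ∈ s, P i * (mOV i + mOM i + mE i)) * (∑ i ∈ s, P i * (gPV i + gPM i)) := by
  -- abbreviations for the global sums
  set QM := ∑ i ∈ s, P i * mPM i with hQM
  set QP := ∑ i ∈ s, P i * (mPV i + mPM i) with hQP
  set O2 := ∑ i ∈ s, P i * (mOV i + mOM i + mE i) with hO2
  set E := ∑ i ∈ s, P i * mE i with hE
  set S1 := ∑ i ∈ s, P i * (gOV i + gOM i) with hS1
  set S2 := ∑ i ∈ s, P i * (mE i * m i) with hS2
  set S3 := ∑ i ∈ s, P i * ((mOV i + mOM i + mE i) * p i) with hS3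
  -- the integrals of the pocket atoms, rewritten through the pocket means
  have hGP : ∑ i ∈ s, P i * (gPV i + gPM i) = ∑ i ∈ s, P i * ((mPV i + mPM i) * p i) := by
    refine Finset.sum_congr rfl ?_
    intro i hi
    rw [hgP i hi]
  have hGPM : ∑ i ∈ s, P i * gPM i = ∑ i ∈ s, P i * (mPM i * m i) := by
    refine Finset.sum_congr rfl ?_
    intro i hi
    rw [hgPM i hi]
  -- nonnegativity of the global masses
  have hQM0 : 0 ≤ QM := by
    rw [hQM]; exact Finset.sum_nonneg (fun i hi => mul_nonneg (hP i hi) (hPM i hi))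
  have hQP0 : 0 ≤ QP := by
    rw [hQP]; exact Finset.sum_nonneg (fun i hi => mul_nonneg (hP i hi) (by linarith [hPV i hi, hPM i hi]))
  -- the summed per-world slack
  have hsum : 0 ≤ S1 + S2 - S3 := by
    have h := Finset.sum_nonneg (fun i hi => mul_nonneg (hP i hi) (hslack i hi))
    have hrw : ∑ i ∈ s, P i * ((gOV i + gOM i) + mE i * m i - (mOV i + mOM i + mE i) * p i) = S1 + S2 - S3 := by
      rw [hS1, hS2, hS3, ← Finset.sum_add_distrib, ← Finset.sum_sub_distrib]
      refine Finset.sum_congr rfl ?_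
      intro i _
      ring
    linarith [hrw ▸ h]
  rw [hGP, hGPM]
  -- goal = QM·QP·(S1+S2−S3) + (the AGG expression)
  have key : 0 ≤ QM * QP * (S1 + S2 - S3) := mul_nonneg (mul_nonneg hQM0 hQP0) hsum
  nlinarith [key, hAGG]

/-- **Covariance form of the world reduction (x-class): (T*)^Y from per-world Harris, per-world K2b and `G2 ≥ π·CM`.**
Worlds `i ∈ s` with weights `P i ≥ 0`, `∑ P = 1`, per-world atom masses summing to `1`; `F i` = total integral of the test
function in world `i`.  Hypotheses: `hHarris` = per-world `Cov_W(f, 1_{O2}) ≥ 0` (Harris in the product world), `hK2b` = per-world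
`E_W[f|E] ≤ E_W[f|PM]` in the multiplied form `gE ≤ mE·m` (`m i` = the PM-pocket mean `gPM i / mPM i`, any real when `mPM i = 0`; for `f(C_x)` at `Y = ∅` this is
vdBHK 2.1, tree `PocketCert.xclass_k2b_frameless`), and `hG2` = the cross-world inequality
`QM·G2 ≥ QP·(QM·Σ P·mE·m − E·I_PM)` i.e. `Cov_{P'}(E_W f, ν_W(O2)) ≥ π·Σ_W P'(W) ν_W(E)(m_W − m̄)` (memo §6: 0 / 4.87·10⁶ for the
x-class, kit j103879; the aggregation form `CP ≥ CM` of `tstar_of_worldAgg_abstract` is rarely FALSE, 49 / 2.97·10⁶, so THIS is the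
hypothesis to aim at).  Conclusion: the global cubic margin `QM·QP·I_O + QP·E·I_PM − QM·O2·I_P ≥ 0` (`= ν'(P)ν'(PM)·(★)`).
Proof: `π(★) = G1 + G2 − BAD`, `G1 = Σ P·hHarris ≥ 0`, `BAD ≤ π·CM` by `hK2b`. [cite: KozmaNitzan2024, Question 8 (§5.5 p. 36)] -/
theorem tstar_of_worldG2_abstract {ι : Type*} (s : Finset ι)
    (P mOV mOM mE mPV mPM gOV gOM gE gPV gPM m : ι → ℝ)
    (hP : ∀ i ∈ s, 0 ≤ P i) (hP1 : ∑ i ∈ s, P i = 1)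
    (hPV : ∀ i ∈ s, 0 ≤ mPV i) (hPM : ∀ i ∈ s, 0 ≤ mPM i)
    (hmass : ∀ i ∈ s, mOV i + mOM i + mE i + mPV i + mPM i = 1)
    (hK2b : ∀ i ∈ s, gE i ≤ mE i * m i)
    (hHarris : ∀ i ∈ s, 0 ≤ (gOV i + gOM i + gE i) - (mOV i + mOM i + mE i) * (gOV i + gOM i + gE i + gPV i + gPM i))
    (hG2 : (∑ i ∈ s, P i * (mPV i + mPM i)) *
        ((∑ i ∈ s, P i * mPM i) * (∑ i ∈ s, P i * (mE i * m i)) - (∑ i ∈ s, P i * mE i) * (∑ i ∈ s, P i * gPM i))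
      ≤ (∑ i ∈ s, P i * mPM i) *
        ((∑ i ∈ s, P i * ((gOV i + gOM i + gE i + gPV i + gPM i) * (mOV i + mOM i + mE i)))
          - (∑ i ∈ s, P i * (gOV i + gOM i + gE i + gPV i + gPM i)) * (∑ i ∈ s, P i * (mOV i + mOM i + mE i)))) :
    0 ≤ (∑ i ∈ s, P i * mPM i) * (∑ i ∈ s, P i * (mPV i + mPM i)) * (∑ i ∈ s, P i * (gOV i + gOM i))
      + (∑ i ∈ s, P i * (mPV i + mPM i)) * (∑ i ∈ s, P i * mE i) * (∑ i ∈ s, P i * gPM i)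
      - (∑ i ∈ s, P i * mPM i) * (∑ i ∈ s, P i * (mOV i + mOM i + mE i)) * (∑ i ∈ s, P i * (gPV i + gPM i)) := by
  set QM := ∑ i ∈ s, P i * mPM i with hQM
  set QP := ∑ i ∈ s, P i * (mPV i + mPM i) with hQP
  set O2 := ∑ i ∈ s, P i * (mOV i + mOM i + mE i) with hO2
  set E := ∑ i ∈ s, P i * mE i with hE
  set IO := ∑ i ∈ s, P i * (gOV i + gOM i) with hIO
  set IE := ∑ i ∈ s, P i * gE i with hIE
  set IP := ∑ i ∈ s, P i * (gPV i + gPM i) with hIP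
  set IPM := ∑ i ∈ s, P i * gPM i with hIPM
  set FF := ∑ i ∈ s, P i * (gOV i + gOM i + gE i + gPV i + gPM i) with hFF
  set X := ∑ i ∈ s, P i * ((gOV i + gOM i + gE i + gPV i + gPM i) * (mOV i + mOM i + mE i)) with hX
  set SM := ∑ i ∈ s, P i * (mE i * m i) with hSM
  have hQM0 : 0 ≤ QM := by
    rw [hQM]; exact Finset.sum_nonneg (fun i hi => mul_nonneg (hP i hi) (hPM i hi))
  have hQP0 : 0 ≤ QP := by
    rw [hQP]; exact Finset.sum_nonneg (fun i hi => mul_nonneg (hP i hi) (by linarith [hPV i hi, hPM i hi]))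
  -- normalisation: O2 + QP = 1
  have hnorm : O2 + QP = 1 := by
    rw [hO2, hQP, ← Finset.sum_add_distrib]
    have : ∑ i ∈ s, (P i * (mOV i + mOM i + mE i) + P i * (mPV i + mPM i)) = ∑ i ∈ s, P i := by
      refine Finset.sum_congr rfl ?_
      intro i hi
      have := hmass i hi
      calc P i * (mOV i + mOM i + mE i) + P i * (mPV i + mPM i) = P i * (mOV i + mOM i + mE i + mPV i + mPM i) := by ring
        _ = P i := by rw [this, mul_one]
    rw [this, hP1]
  -- FF = IO + IE + IP
  have hFsplit : FF = IO + IE + IP := by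
    rw [hFF, hIO, hIE, hIP, ← Finset.sum_add_distrib, ← Finset.sum_add_distrib]
    refine Finset.sum_congr rfl ?_
    intro i _
    ring
  -- G1 = Σ P·Harris_i = (IO + IE) − X ≥ 0
  have hG1 : 0 ≤ IO + IE - X := by
    have h := Finset.sum_nonneg (fun i hi => mul_nonneg (hP i hi) (hHarris i hi))
    have hrw : ∑ i ∈ s, P i * ((gOV i + gOM i + gE i) - (mOV i + mOM i + mE i) * (gOV i + gOM i + gE i + gPV i + gPM i)) = IO + IE - X := by
      rw [hIO, hIE, hX, ← Finset.sum_add_distrib, ← Finset.sum_sub_distrib]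
      refine Finset.sum_congr rfl ?_
      intro i _
      ring
    linarith [hrw ▸ h]
  -- K2b summed: IE ≤ SM
  have hK : IE ≤ SM := by
    rw [hIE, hSM]
    exact Finset.sum_le_sum (fun i hi => mul_le_mul_of_nonneg_left (hK2b i hi) (hP i hi))
  -- assemble: goal = QM·[QP(IO+IE) − O2·IP] − QP·(QM·IE − E·IPM), and QP(IO+IE) − O2·IP = (IO+IE) − FF·O2 = G1 + G2
  have hQPK : 0 ≤ QP * QM * (SM - IE) := mul_nonneg (mul_nonneg hQP0 hQM0) (by linarith)
  have hG1' : 0 ≤ QM * (IO + IE - X) := mul_nonneg hQM0 hG1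
  have hO2eq : O2 = 1 - QP := by linarith
  rw [hO2eq] at hG2 ⊢
  rw [hFsplit] at hG2
  nlinarith [hG2, hQPK, hG1', hQM0, hQP0]

end PocketCert

end Summit.CriticalPhenomena.PercolationContinuityZ3.Theorems
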